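import Summits.BirchSwinnertonDyer.BirchSwinnertonDyer.Theorems.CycTangentCMCycTangentBoundWitnessCurves
import Summits.BirchSwinnertonDyer.BirchSwinnertonDyer.Theorems.CycTangentCMCycTangentBoundSplitPrimeCertificate
import HarnessLib

/-!
# Crux `CycTangentCM.CycTangentBound` (stmt-BirchSwinnertonDyer-22628), negative road: the CONSUMABLE
# INTERFACE at the two witness curves — `¬ CycTangentBound` from a forward-difference certificate on every
# `ψ⁻¹`-frame at `(W1, 7)` / `(W2, 7)` (`--supports 22628`; nothing is closed; the crux is NOT claimed false here;
# BSD is not proved)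

Seat `prover-bsd-line-ctcm-p5` (D-0145 line `route-BirchSwinnertonDyer-CycTangentCM`, line `tangent-cone-parity`),
sequel of `CycTangentCMCycTangentBoundWitnessCurves` (anchor binders of the witnesses `W1 = [0,0,0,0,−2]`,
`W2 = [0,0,1,0,−33163]` at `p = 7`, kernel-decided; frame packages `exists_frame_wi_7` modulo de Shalit II.4.17 +
Deuring) composed with -p3's N-line assembly `not_cycTangentBound_of_fwdDiffCertificate` (p589997):

* `not_cycTangentBound_of_frameCertificate_w1_7`, `not_cycTangentBound_of_frameCertificate_w2_7` — **the consumable interface of the negative road at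
  the witness**: granted the two frame facts, if EVERY `ψ⁻¹`-frame `G` at `(Wi, 7)` carries a forward-difference
  certificate on one line together with the cyclotomic non-unit segment (the data of -p3's
  `not_cycTangentBound_of_fwdDiffCertificate`, p589997), then `¬ CycTangentBound` — the frame is supplied by
  `exists_frame_wi_7`, the anchor binders by `anchor_wi_7`; what the lead's numerical facts must produce is
  exactly the hypothesis `hcert`.


So the lead's `Negative/…FalseOfNumerics` file has to produce exactly `hcert` from the split-prime power line
(p588596), the cyclotomic segment (p586224 + `λ_7 = 5` in MSD currency) and the named numerical facts (the two
value norms); everything else of the instantiation is here.  Theorems only; no `def`, no named fact, no `sorry`.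
References: [deShalit1987] II.4.16–4.17; [Mazur1978] §6 Prop. 6.3 (1); lead memo `Cruxes/CycTangentBound/REFUTED.md`.
-/

set_option linter.dupNamespace false
set_option autoImplicit false

noncomputable section

open scoped Classical NumberField
open WeierstrassCurve NumberField IsDedekindDomain Field Finset
open Literature.NumberTheory.EllipticCurves Literature.NumberTheory.GaloisRepresentations
open Summit.BirchSwinnertonDyer.BirchSwinnertonDyer.Theorems

namespace Summit.BirchSwinnertonDyer.BirchSwinnertonDyer.Theorems.CycTangentCMWitness

/-! ## `¬ CycTangentBound` from a certificate on every frame at the witness -/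

/-- **Negative road at the witness `(W1, 7)`, kernel interface.**  Granted de Shalit II.4.17 and Deuring
(which supply a `ψ⁻¹`-frame at `(W1, 7)`, `exists_frame_w1_7`): if every `ψ⁻¹`-twisted two-variable frame `G`
at `(W1, 7)` carries, on SOME line `monomialLine c₁ c₂ G`, node data `u ≠ 1`, `‖u − 1‖ < 1`, a drift `η`,
`k < 7`, values at `u^t − 1` (`t ≤ k`) with the forward-difference certificate (`‖D_j‖ < ‖u − 1‖^j` for
`j < k`, `‖D_k‖ = ‖u − 1‖^k`) AND the cyclotomic non-unit segment `[T^m]G(0,T) ∈ 𝔪` (`m ≤ k + 1`), then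
`CycTangentBound` is false — -p3's `not_cycTangentBound_of_fwdDiffCertificate` at the anchor `anchor_w1_7`.
Nothing here asserts that the certificate exists (that is the lead's numerical content).
[cite: deShalit1987, II.4.16–4.17] [cite: Mazur1978, §6 Prop. 6.3 (1)] -/
theorem not_cycTangentBound_of_frameCertificate_w1_7 (hdS : DeShalit1987.thmII417_exists_katzSheet)
    (hDeu : Deuring_exists_heckeCharacter_of_maximalCM)
    (hcert : haveI := isElliptic_cm0m2
      ∀ (K : Type) [Field K] [NumberField K],
        IsCMFieldOfJ K (⟨0, 0, 0, 0, -2⟩ : WeierstrassCurve ℚ).j →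
      ∀ (ψ : HeckeCharacter K), ψ.HasInfinityType (fun _ ↦ 1) (fun _ ↦ 0) →
        (∀ s : ℂ, 3 / 2 < s.re →
          heckeLFunction ψ s = (⟨0, 0, 0, 0, -2⟩ : WeierstrassCurve ℚ).LSeries s) →
      ∀ (ι : PadicAlgCl 7 ≃+* ℂ) (v vbar : HeightOneSpectrum (𝓞 K)),
        ((7 : ℕ) : 𝓞 K) ∈ v.asIdeal → ((7 : ℕ) : 𝓞 K) ∈ vbar.asIdeal → vbar ≠ v →
        (∀ (w : InfinitePlace K) (k : 𝓞 K), k ∈ v.asIdeal ↔ ‖ι.symm (w.embedding (k : K))‖ < 1) →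
      ∀ (S : Finset (HeightOneSpectrum (𝓞 K))), v ∉ S → vbar ∉ S →
        (∀ w ∈ S, ¬ ψ.IsUnramifiedAt w) →
        (∀ w : HeightOneSpectrum (𝓞 K), w ∉ S → ψ.IsUnramifiedAt w) →
      ∀ (κ₁ κ₂ : ZpExtension K 7) (γ₁ γ₂ : absoluteGaloisGroup K),
        ZpExtension.IsTopGeneratorPair κ₁ κ₂ γ₁ γ₂ → κ₂.IsCyclotomic →
        (∃ ζ : ℤ_[7]ˣ, IsOfFinOrder ζ ∧
          ((GaloisRep.cyclotomicCharacter K 7 γ₂ * ζ : ℤ_[7]ˣ) : ℤ_[7]) =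
            (cyclotomicGenerator 7 : ℤ_[7])) →
      ∀ (Ω δ : ℂ) (Ωp : ℂ_[7]), Ω ≠ 0 → Ωp ≠ 0 →
        (δ ^ 2 = (NumberField.discr K : ℂ) ∨ δ ^ 2 = -(NumberField.discr K : ℂ)) →
      ∀ (G : PowerSeries (PowerSeries (PadicComplexInt 7))),
        IsKatzMeasure₂ ι v vbar S κ₁ κ₂ γ₁ γ₂ ψ⁻¹ Ω δ Ωp G →
      ∃ (c₁ c₂ : ℤ_[7]) (u η : ℂ_[7]) (k : ℕ) (val : ℕ → ℂ_[7]),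
        u - 1 ≠ 0 ∧ ‖u - 1‖ < 1 ∧ ‖η - 1‖ ≤ ‖u - 1‖ ∧ k < 7 ∧
        (∀ t, t ≤ k → IntSeries.HasValueAt (IntSeries.monomialLine c₁ c₂ G) (u ^ t - 1) (val t)) ∧
        (∀ j, j < k →
          ‖∑ t ∈ Finset.range (j + 1), IntSeries.fwdDiffWeight 7 j t * (η ^ t * val t)‖ <
            ‖u - 1‖ ^ j) ∧
        ‖∑ t ∈ Finset.range (k + 1), IntSeries.fwdDiffWeight 7 k t * (η ^ t * val t)‖ = ‖u - 1‖ ^ k ∧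
        ∀ m : ℕ, m ≤ k + 1 → ¬ IsUnit (PowerSeries.coeff m (PowerSeries.constantCoeff G))) :
    ¬ Summit.BirchSwinnertonDyer.BirchSwinnertonDyer.Theses.CycTangentCM.CycTangentBound := by
  haveI := isElliptic_cm0m2
  haveI := isGloballyMinimal_cm0m2
  haveI : Fact (Nat.Prime 7) := ⟨by norm_num⟩
  obtain ⟨h5, hj, hgood, hord, hirr⟩ := anchor_w1_7
  obtain ⟨K, _, _, hK, ψ, hψ, hL, ι, v, vbar, hv, hvbar, hne, hι, S, hvS, hvbS, hSram, hSunr, κ₁, κ₂, γ₁, γ₂,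
    hpair, hcyc, hγ₂, Ω, δ, Ωp, hΩ, hΩp, hδ, G, hG⟩ := exists_frame_w1_7 hdS hDeu
  obtain ⟨c₁, c₂, u, η, k, val, hu0, hu1, hη, hk, hval, hlow, htop, hgap⟩ :=
    hcert K hK ψ hψ hL ι v vbar hv hvbar hne hι S hvS hvbS hSram hSunr κ₁ κ₂ γ₁ γ₂ hpair hcyc hγ₂ Ω δ Ωp
      hΩ hΩp hδ G hG
  exact not_cycTangentBound_of_fwdDiffCertificate _ 7 h5 hj hgood hord hirr K hK ψ hψ hL ι v vbar hv hvbar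
    hne hι S hvS hvbS hSram hSunr κ₁ κ₂ γ₁ γ₂ hpair hcyc hγ₂ Ω δ Ωp hΩ hΩp hδ G hG c₁ c₂ u η k val hu0 hu1
    hη hk hval hlow htop hgap

/-- **Negative road at the witness `(W2, 7)`, kernel interface** — as
`not_cycTangentBound_of_frameCertificate_w1_7` for `W2 = [0,0,1,0,−33163]`.
[cite: deShalit1987, II.4.16–4.17] [cite: Mazur1978, §6 Prop. 6.3 (1)] -/
theorem not_cycTangentBound_of_frameCertificate_w2_7 (hdS : DeShalit1987.thmII417_exists_katzSheet)
    (hDeu : Deuring_exists_heckeCharacter_of_maximalCM)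
    (hcert : haveI := isElliptic_w2
      ∀ (K : Type) [Field K] [NumberField K],
        IsCMFieldOfJ K (⟨0, 0, 1, 0, -33163⟩ : WeierstrassCurve ℚ).j →
      ∀ (ψ : HeckeCharacter K), ψ.HasInfinityType (fun _ ↦ 1) (fun _ ↦ 0) →
        (∀ s : ℂ, 3 / 2 < s.re →
          heckeLFunction ψ s = (⟨0, 0, 1, 0, -33163⟩ : WeierstrassCurve ℚ).LSeries s) →
      ∀ (ι : PadicAlgCl 7 ≃+* ℂ) (v vbar : HeightOneSpectrum (𝓞 K)),
        ((7 : ℕ) : 𝓞 K) ∈ v.asIdeal → ((7 : ℕ) : 𝓞 K) ∈ vbar.asIdeal → vbar ≠ v →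
        (∀ (w : InfinitePlace K) (k : 𝓞 K), k ∈ v.asIdeal ↔ ‖ι.symm (w.embedding (k : K))‖ < 1) →
      ∀ (S : Finset (HeightOneSpectrum (𝓞 K))), v ∉ S → vbar ∉ S →
        (∀ w ∈ S, ¬ ψ.IsUnramifiedAt w) →
        (∀ w : HeightOneSpectrum (𝓞 K), w ∉ S → ψ.IsUnramifiedAt w) →
      ∀ (κ₁ κ₂ : ZpExtension K 7) (γ₁ γ₂ : absoluteGaloisGroup K),
        ZpExtension.IsTopGeneratorPair κ₁ κ₂ γ₁ γ₂ → κ₂.IsCyclotomic →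
        (∃ ζ : ℤ_[7]ˣ, IsOfFinOrder ζ ∧
          ((GaloisRep.cyclotomicCharacter K 7 γ₂ * ζ : ℤ_[7]ˣ) : ℤ_[7]) =
            (cyclotomicGenerator 7 : ℤ_[7])) →
      ∀ (Ω δ : ℂ) (Ωp : ℂ_[7]), Ω ≠ 0 → Ωp ≠ 0 →
        (δ ^ 2 = (NumberField.discr K : ℂ) ∨ δ ^ 2 = -(NumberField.discr K : ℂ)) →
      ∀ (G : PowerSeries (PowerSeries (PadicComplexInt 7))),
        IsKatzMeasure₂ ι v vbar S κ₁ κ₂ γ₁ γ₂ ψ⁻¹ Ω δ Ωp G →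
      ∃ (c₁ c₂ : ℤ_[7]) (u η : ℂ_[7]) (k : ℕ) (val : ℕ → ℂ_[7]),
        u - 1 ≠ 0 ∧ ‖u - 1‖ < 1 ∧ ‖η - 1‖ ≤ ‖u - 1‖ ∧ k < 7 ∧
        (∀ t, t ≤ k → IntSeries.HasValueAt (IntSeries.monomialLine c₁ c₂ G) (u ^ t - 1) (val t)) ∧
        (∀ j, j < k →
          ‖∑ t ∈ Finset.range (j + 1), IntSeries.fwdDiffWeight 7 j t * (η ^ t * val t)‖ <
            ‖u - 1‖ ^ j) ∧
        ‖∑ t ∈ Finset.range (k + 1), IntSeries.fwdDiffWeight 7 k t * (η ^ t * val t)‖ = ‖u - 1‖ ^ k ∧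
        ∀ m : ℕ, m ≤ k + 1 → ¬ IsUnit (PowerSeries.coeff m (PowerSeries.constantCoeff G))) :
    ¬ Summit.BirchSwinnertonDyer.BirchSwinnertonDyer.Theses.CycTangentCM.CycTangentBound := by
  haveI := isElliptic_w2
  haveI := isGloballyMinimal_w2
  haveI : Fact (Nat.Prime 7) := ⟨by norm_num⟩
  obtain ⟨h5, hj, hgood, hord, hirr⟩ := anchor_w2_7
  obtain ⟨K, _, _, hK, ψ, hψ, hL, ι, v, vbar, hv, hvbar, hne, hι, S, hvS, hvbS, hSram, hSunr, κ₁, κ₂, γ₁, γ₂,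
    hpair, hcyc, hγ₂, Ω, δ, Ωp, hΩ, hΩp, hδ, G, hG⟩ := exists_frame_w2_7 hdS hDeu
  obtain ⟨c₁, c₂, u, η, k, val, hu0, hu1, hη, hk, hval, hlow, htop, hgap⟩ :=
    hcert K hK ψ hψ hL ι v vbar hv hvbar hne hι S hvS hvbS hSram hSunr κ₁ κ₂ γ₁ γ₂ hpair hcyc hγ₂ Ω δ Ωp
      hΩ hΩp hδ G hG
  exact not_cycTangentBound_of_fwdDiffCertificate _ 7 h5 hj hgood hord hirr K hK ψ hψ hL ι v vbar hv hvbar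
    hne hι S hvS hvbS hSram hSunr κ₁ κ₂ γ₁ γ₂ hpair hcyc hγ₂ Ω δ Ωp hΩ hΩp hδ G hG c₁ c₂ u η k val hu0 hu1
    hη hk hval hlow htop hgap

end Summit.BirchSwinnertonDyer.BirchSwinnertonDyer.Theorems.CycTangentCMWitness

end
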